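import Summits.ABC.IUTFork.LDHTensor
import Summits.ABC.IUTFork.LDHEstimateAssembly
import Literature.IUT.LogVolume.TensorPacketStepV
import Literature.IUT.LogVolume.TensorPacketLogHolds
import HarnessLib

/-!
# The fork at [IUTchIII] Corollary 3.12, L-DH level: the per-summand Step (v) bound ("D9′") for Dupuy–Hilado
# data over the REAL tensor-packet model — the hypothesis `h` of `DHData.estimateDH_of_componentBounds`

Record-only file (D-0012) of the abc-iut cell (WAVE-3 discharge seat abc-iut-c312-d1; plan/D9PRIME-OBLIGATIONS.md
row O2); TAKES NO SIDE. Mochizuki, *Inter-universal Teichmüller theory IV* (RIMS ms Apr. 2020), proof of Thm. 1.10,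
Step (v), p. 27–28; Dupuy–Hilado, arXiv:2004.13228, §3.9, §4.7–4.12.

Over abc-iut-c312-3's `DHData.ofTensor X 𝔽 d T …` (`LDHTensor.lean`: Dupuy–Hilado data over the model
`tensorPacketModel 𝔽`, REAL at every prime) this file derives, from `TensorPacketStepV.realPrimePacket_stepV`, the
PER-SUMMAND input of abc-iut-S2's `DHData.estimateDH_of_componentBounds` (`LDHEstimateAssembly.lean`):
for `p` prime, degree `j = i+1 ≤ ℓ⋇`, collection `v⃗ ∈ V(F)_p^{j+1}`,
`log μ̄(hull(U_Θ)_{p,j,v⃗}) ≤ log μ̄(O_𝕃(−P_Θ)_{p,j,v⃗}) + δ(p,j,v⃗)` with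
`δ(p,j,v⃗) = {θ(v_j) − θ(v_{i₀})} + {d_I + 1}·log(p) + Σ_{i∈I*}{3 + log(e_i)}`, `θ(v) := P_{Θ,j}(v)·ln|κ(v)|/n_v`
(`= −log‖t_{Θ,j,v}‖`, Dupuy–Hilado (3.4)), `v_{i₀}` a slot of LEAST `θ` — under THREE named inputs:
[IUTchIV] Prop. 1.2 (ii) for the packet (`Prop12ii`; proved by the Prop. 1.1/1.2 companions), the tameness set
`I*`, and the SHARP reading of (Ind3) on the `S_{j+1}`-orbit of `v⃗`
(`(O_𝕃(−P_Θ))^{Ind3}_{v⃗∘σ} = O_𝕃(−P_Θ)_{v⃗∘σ}`; with (4.10) read with `0 ∈ ℕ` only a `q`-insensitive bound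
exists — `LDHWitnessEstimate`). In three steps: `PrimePacket.regionOf_succ_eq` (the bare region in degree `i+1`),
`realPrimePacket_componentBound` (the bound for raw `p`-local data over the real packet, orders read through
`ord_v(t_{Θ,j,v}) = P_{Θ,j}(v)`), `PrimePacket.componentBound_of_eq` (transport along an equality of packets),
`DHData.componentBound_ofTensor` (the model's `p`-part IS the real packet; `hullUTheta_eq_localHull`,
`region_eq_regionOf`). [cite: Mochizuki2012, IUTchIV Thm 1.10 proof Step (v) p.27–28]
[cite: DupuyHilado2025, §3.4, §3.9, §4.7, §4.11, §4.12] [claim: Mochizuki2012, status: disputed]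
HONEST SCOPE: every input above is a hypothesis; nothing asserts that Mochizuki's Θ-pilot satisfies them, and
(1.1)/`Cor312DH` is untouched. The arithmetic turning `δ` into the printed per-prime display of Step (v)
((R4), `a_i`, `b_i`, `d_i` estimates; `collBound`) is abc-iut-S8's/abc-iut-S3's, not done here.
-/

noncomputable section

open Set NumberField IsDedekindDomain
open scoped Pointwise

namespace Literature.IUT.LogVolume

variable {F : Type} [Field F] [NumberField F]

namespace PrimePacket

/-- The bare region in a degree `j = i+1 ≤ ℓ⋇`: `O_𝕃(−div t)_{v⃗} = t_{j,v_j}·O_{v⃗}` (peel at the last slot).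
[cite: DupuyHilado2025, §3.9] -/
theorem regionOf_succ_eq {p : ℕ} (Q : PrimePacket F p) {lstar : ℕ}
    (t : Fin lstar → (v : placesOver F p) → Q.Λ v) (i : Fin lstar)
    (e : Fin ((i : ℕ) + 1 + 1) → placesOver F p) :
    Q.regionOf t ((i : ℕ) + 1) e = Q.peel (t i (e (Fin.last _))) '' Q.O _ e := by
  have h : 0 < (i : ℕ) + 1 ∧ (i : ℕ) + 1 - 1 < lstar := ⟨Nat.succ_pos _, by have := i.2; omega⟩
  simp only [regionOf, dif_pos h]
  rfl

end PrimePacket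

/-! ## The bound for raw `p`-local data over the real packet -/

section Real

variable {p : ℕ} [Fact p.Prime] (𝔽 : LocalFields F p) (X : PilotData F)

/-- `log‖t‖ = −ord_v(t)·ln|κ(v)|/n_v`: a scalar with `ord_v(t_{Θ,j,v}) = P_{Θ,j}(v)` has
`log‖t‖ = −P_{Θ,j}(v)·ln|κ(v)|/n_v`. [cite: DupuyHilado2025, §3.4, §3.9] -/
theorem log_norm_of_ordv_eq {v : placesOver F p} (a : (𝔽.k v)ˣ) {r : ℝ} (ha : 𝔽.ordv a = r) :
    Real.log ‖(a : 𝔽.k v)‖ = -(r * logNorm F v.1 / localDegree F v.1) := by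
  rw [𝔽.log_norm_eq_neg_ordv a, ha, neg_mul, neg_div]

/-- **The per-summand Step (v) bound over the real packet, for `p`-local Dupuy–Hilado data**: degree `j = i+1`,
theta scalars `t_{Θ,j,v}` with `ord_v = P_{Θ,j}(v)`, a region `B` with `O_𝕃(−P_Θ)_{v⃗} ⊆ B_{v⃗}` and the SHARP
(Ind3) reading on the `S_{j+1}`-orbit of `v⃗`; then the local hull is admissible and
`log μ̄(hull) ≤ log μ̄(O_𝕃(−P_Θ)_{v⃗}) + {θ(v_j) − θ(v_{i₀})} + {d_I + 1}·log(p) + Σ_{i∈I*}{3 + log(e_i)}`.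
[cite: Mochizuki2012, IUTchIV Thm 1.10 proof Step (v) p.27–28] [cite: DupuyHilado2025, §3.9, §4.11] -/
theorem realPrimePacket_componentBound (i : Fin X.lstar) (e : Fin ((i : ℕ) + 1 + 1) → placesOver F p)
    (h12 : Prop12ii p (fun a => 𝔽.k (e a)))
    (t : Fin X.lstar → (v : placesOver F p) → (𝔽.k v)ˣ)
    (ht : ∀ v : placesOver F p, 𝔽.ordv (t i v) = X.thetaPilot i v.1)
    (B : (realPrimePacket p 𝔽).Region)
    (hB : (realPrimePacket p 𝔽).regionOf t ((i : ℕ) + 1) e ⊆ B _ e)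
    (hsharp : ∀ σ : Equiv.Perm (Fin ((i : ℕ) + 1 + 1)),
      B _ (e ∘ σ) ⊆ (realPrimePacket p 𝔽).regionOf t ((i : ℕ) + 1) (e ∘ σ))
    (Istar : Finset (Fin ((i : ℕ) + 1 + 1)))
    (htame : ∀ a, a ∉ Istar → absRamificationIdx p (𝔽.k (e a)) ≤ p - 2)
    (i₀ : Fin ((i : ℕ) + 1 + 1))
    (hmin : ∀ a, X.thetaPilot i (e i₀).1 * logNorm F (e i₀).1 / localDegree F (e i₀).1 ≤
      X.thetaPilot i (e a).1 * logNorm F (e a).1 / localDegree F (e a).1) :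
    (realPrimePacket p 𝔽).adm ((realPrimePacket p 𝔽).localHull B _ e) ∧
      (realPrimePacket p 𝔽).logμ ((realPrimePacket p 𝔽).localHull B _ e) ≤
        (realPrimePacket p 𝔽).logμ ((realPrimePacket p 𝔽).regionOf t ((i : ℕ) + 1) e)
          + ((X.thetaPilot i (e (Fin.last _)).1 * logNorm F (e (Fin.last _)).1 / localDegree F (e (Fin.last _)).1
              - X.thetaPilot i (e i₀).1 * logNorm F (e i₀).1 / localDegree F (e i₀).1)
            + (dSum p (fun a => 𝔽.k (e a)) + 1) * Real.log p
            + ∑ a ∈ Istar, (3 + Real.log (absRamificationIdx p (𝔽.k (e a))))) := by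
  have hj : 1 ≤ (i : ℕ) + 1 := by omega
  -- the bare regions are the twists through the last slot
  have hreg : ∀ e' : Fin ((i : ℕ) + 1 + 1) → placesOver F p,
      (realPrimePacket p 𝔽).regionOf t ((i : ℕ) + 1) e' =
        (realPrimePacket p 𝔽).peel (t i (e' (Fin.last _))) '' (realPrimePacket p 𝔽).O _ e' :=
    fun e' => PrimePacket.regionOf_succ_eq (realPrimePacket p 𝔽) t i e'
  -- the log-norms of the theta scalars
  have hlog : ∀ a, Real.log ‖(t i (e a) : 𝔽.k (e a))‖ =
      -(X.thetaPilot i (e a).1 * logNorm F (e a).1 / localDegree F (e a).1) :=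
    fun a => log_norm_of_ordv_eq 𝔽 (t i (e a)) (ht (e a))
  have hmax : ∀ a, ‖(t i (e a) : 𝔽.k (e a))‖ ≤ ‖(t i (e i₀) : 𝔽.k (e i₀))‖ := by
    intro a
    rw [← Real.log_le_log_iff (norm_pos_iff.mpr (t i (e a)).ne_zero) (norm_pos_iff.mpr (t i (e i₀)).ne_zero),
      hlog, hlog]
    exact neg_le_neg (hmin a)
  have hB' : (realPrimePacket p 𝔽).peel (t i (e (Fin.last _))) '' (realPrimePacket p 𝔽).O _ e ⊆ B _ e := by
    rw [← hreg]; exact hB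
  have hsharp' : ∀ σ : Equiv.Perm (Fin ((i : ℕ) + 1 + 1)),
      B _ (e ∘ σ) ⊆ (realPrimePacket p 𝔽).peel (t i (e (σ (Fin.last _)))) '' (realPrimePacket p 𝔽).O _ (e ∘ σ) := by
    intro σ
    have := hsharp σ
    rw [hreg] at this
    exact this
  have hv := realPrimePacket_stepV p 𝔽 hj e h12 (t i) B hsharp' hB' Istar htame i₀ hmax
  refine ⟨hv.1, ?_⟩
  have h2 := hv.2
  rw [hlog i₀, hlog (Fin.last _)] at h2
  rw [hreg e]
  show packetLogμ p (fun a => 𝔽.k (e a)) (packetHull p (fun a => 𝔽.k (e a))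
      (⋃ (g : (realPrimePacket p 𝔽).G₂ _ e) (σ : Equiv.Perm (Fin ((i : ℕ) + 1 + 1))),
        g • ((realPrimePacket p 𝔽).perm σ e '' B _ (e ∘ σ)))) ≤
    packetLogμ p (fun a => 𝔽.k (e a))
        ((realPrimePacket p 𝔽).peel (t i (e (Fin.last _))) '' (realPrimePacket p 𝔽).O _ e) + _
  linarith

end Real

/-! ## Transport along an equality of prime packets -/

namespace PrimePacket

variable {p : ℕ} [Fact p.Prime] (𝔽 : LocalFields F p) (X : PilotData F)

/-- The same bound for ANY prime packet EQUAL to the real one (the `p`-part of a model assembled by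
`IndPacketModel.ofPrimesLine`). [cite: DupuyHilado2025, Def. 3.6.3] -/
theorem componentBound_of_eq (Q : PrimePacket F p) (hQ : Q = realPrimePacket p 𝔽)
    (i : Fin X.lstar) (e : Fin ((i : ℕ) + 1 + 1) → placesOver F p)
    (h12 : Prop12ii p (fun a => 𝔽.k (e a)))
    (t : Fin X.lstar → (v : placesOver F p) → Q.Λ v)
    (ht : ∀ v : placesOver F p, Q.ordv (t i v) = X.thetaPilot i v.1)
    (B : Q.Region) (hB : Q.regionOf t ((i : ℕ) + 1) e ⊆ B _ e)
    (hsharp : ∀ σ : Equiv.Perm (Fin ((i : ℕ) + 1 + 1)), B _ (e ∘ σ) ⊆ Q.regionOf t ((i : ℕ) + 1) (e ∘ σ))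
    (Istar : Finset (Fin ((i : ℕ) + 1 + 1)))
    (htame : ∀ a, a ∉ Istar → absRamificationIdx p (𝔽.k (e a)) ≤ p - 2)
    (i₀ : Fin ((i : ℕ) + 1 + 1))
    (hmin : ∀ a, X.thetaPilot i (e i₀).1 * logNorm F (e i₀).1 / localDegree F (e i₀).1 ≤
      X.thetaPilot i (e a).1 * logNorm F (e a).1 / localDegree F (e a).1) :
    Q.adm (Q.localHull B _ e) ∧
      Q.logμ (Q.localHull B _ e) ≤ Q.logμ (Q.regionOf t ((i : ℕ) + 1) e)
        + ((X.thetaPilot i (e (Fin.last _)).1 * logNorm F (e (Fin.last _)).1 / localDegree F (e (Fin.last _)).1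
            - X.thetaPilot i (e i₀).1 * logNorm F (e i₀).1 / localDegree F (e i₀).1)
          + (dSum p (fun a => 𝔽.k (e a)) + 1) * Real.log p
          + ∑ a ∈ Istar, (3 + Real.log (absRamificationIdx p (𝔽.k (e a))))) := by
  subst hQ
  exact realPrimePacket_componentBound 𝔽 X i e h12 t ht B hB hsharp Istar htame i₀ hmin

end PrimePacket

end Literature.IUT.LogVolume

/-! ## The bound for `DHData.ofTensor` -/

namespace Summit.ABC.IUTFork

open Literature.IUT.LogVolume NumberField IsDedekindDomain
open scoped Pointwise

variable {F : Type} [Field F] [NumberField F]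

namespace DHData

/-- **D9′, per summand, for Dupuy–Hilado data over the REAL tensor-packet model.** For
`D = DHData.ofTensor X 𝔽 d T …`, a prime `p`, a degree `j = i+1`, a collection `v⃗`, given [IUTchIV] Prop. 1.2
(ii) for the packet `⊗ K_{v̲_a}`, a tameness set `I*`, the SHARP (Ind3) reading on the `S_{j+1}`-orbit of `v⃗`,
and a slot `i₀` of least `θ = P_{Θ,j}·ln|κ|/n`:
`log μ̄(hull(U_Θ)_{p,j,v⃗}) ≤ log μ̄(O_𝕃(−P_Θ)_{p,j,v⃗}) + {θ(v_j) − θ(v_{i₀})} + {d_I + 1}·log(p) + Σ_{a∈I*}{3 + log(e_a)}`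
— the hypothesis `h` of `estimateDH_of_componentBounds` at `(p, j, v⃗)` with this `δ`.
[cite: Mochizuki2012, IUTchIV Thm 1.10 proof Step (v) p.27–28] [claim: Mochizuki2012, status: disputed] -/
theorem componentBound_ofTensor (X : PilotData F) (𝔽 : LocalFieldFamily F)
    (d : ∀ (p : ℕ) (hp : p.Prime), (@realPrimePacket F _ _ p ⟨hp⟩ (𝔽 p hp)).DHDatum X)
    (T : Finset ℕ) (T_prime : ∀ p ∈ T, p.Prime) (S_sub : ∀ v ∈ X.S, residueChar F v ∈ T)
    {p : ℕ} [hp : Fact p.Prime] (i : Fin X.lstar) (e : Fin ((i : ℕ) + 1 + 1) → placesOver F p)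
    (h12 : Prop12ii p (fun a => (𝔽 p hp.out).k (e a)))
    (hsharp : ∀ σ : Equiv.Perm (Fin ((i : ℕ) + 1 + 1)),
      (ofTensor X 𝔽 d T T_prime S_sub).ind3.bare3 p _ (e ∘ σ) ⊆
        (ofTensor X 𝔽 d T T_prime S_sub).M.region (ofTensor X 𝔽 d T T_prime S_sub).tΘ p _ (e ∘ σ))
    (Istar : Finset (Fin ((i : ℕ) + 1 + 1)))
    (htame : ∀ a, a ∉ Istar → absRamificationIdx p ((𝔽 p hp.out).k (e a)) ≤ p - 2)
    (i₀ : Fin ((i : ℕ) + 1 + 1))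
    (hmin : ∀ a, X.thetaPilot i (e i₀).1 * logNorm F (e i₀).1 / localDegree F (e i₀).1 ≤
      X.thetaPilot i (e a).1 * logNorm F (e a).1 / localDegree F (e a).1) :
    (ofTensor X 𝔽 d T T_prime S_sub).M.logμ
        ((ofTensor X 𝔽 d T T_prime S_sub).M.hullUTheta (ofTensor X 𝔽 d T T_prime S_sub).ind3 p _ e) ≤
      (ofTensor X 𝔽 d T T_prime S_sub).M.logμ
          ((ofTensor X 𝔽 d T T_prime S_sub).M.region (ofTensor X 𝔽 d T T_prime S_sub).tΘ p _ e)
        + ((X.thetaPilot i (e (Fin.last _)).1 * logNorm F (e (Fin.last _)).1 / localDegree F (e (Fin.last _)).1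
            - X.thetaPilot i (e i₀).1 * logNorm F (e i₀).1 / localDegree F (e i₀).1)
          + (dSum p (fun a => (𝔽 p hp.out).k (e a)) + 1) * Real.log p
          + ∑ a ∈ Istar, (3 + Real.log (absRamificationIdx p ((𝔽 p hp.out).k (e a))))) := by
  set D := ofTensor X 𝔽 d T T_prime S_sub with hD
  rw [D.M.hullUTheta_eq_localHull D.ind3 p _ e]
  have hQ : D.M.primePart p = realPrimePacket p (𝔽 p hp.out) := primePart_tensorPacketModel 𝔽 hp.out
  exact (PrimePacket.componentBound_of_eq (𝔽 p hp.out) X (D.M.primePart p) hQ i e h12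
    (fun i' v => D.tΘ i' p v) (fun v => D.tΘ_ord i p v) (D.M.regionAt D.ind3.bare3 p)
    (D.ind3.region_subset p _ e) hsharp Istar htame i₀ hmin).2


/-- The same with the degree written as `j` (`1 ≤ j ≤ ℓ⋇`, `P_{Θ,j} = X.thetaPilot ⟨j−1, _⟩`).
[cite: Mochizuki2012, IUTchIV Thm 1.10 proof Step (v) p.27–28] [claim: Mochizuki2012, status: disputed] -/
theorem componentBound_ofTensor' (X : PilotData F) (𝔽 : LocalFieldFamily F)
    (d : ∀ (p : ℕ) (hp : p.Prime), (@realPrimePacket F _ _ p ⟨hp⟩ (𝔽 p hp)).DHDatum X)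
    (T : Finset ℕ) (T_prime : ∀ p ∈ T, p.Prime) (S_sub : ∀ v ∈ X.S, residueChar F v ∈ T)
    {p : ℕ} [hp : Fact p.Prime] {j : ℕ} (hj : 1 ≤ j) (hjl : j ≤ X.lstar) (e : Fin (j + 1) → placesOver F p)
    (h12 : Prop12ii p (fun a => (𝔽 p hp.out).k (e a)))
    (hsharp : ∀ σ : Equiv.Perm (Fin (j + 1)),
      (ofTensor X 𝔽 d T T_prime S_sub).ind3.bare3 p j (e ∘ σ) ⊆
        (ofTensor X 𝔽 d T T_prime S_sub).M.region (ofTensor X 𝔽 d T T_prime S_sub).tΘ p j (e ∘ σ))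
    (Istar : Finset (Fin (j + 1)))
    (htame : ∀ a, a ∉ Istar → absRamificationIdx p ((𝔽 p hp.out).k (e a)) ≤ p - 2)
    (i₀ : Fin (j + 1))
    (hmin : ∀ a, X.thetaPilot ⟨j - 1, by omega⟩ (e i₀).1 * logNorm F (e i₀).1 / localDegree F (e i₀).1 ≤
      X.thetaPilot ⟨j - 1, by omega⟩ (e a).1 * logNorm F (e a).1 / localDegree F (e a).1) :
    (ofTensor X 𝔽 d T T_prime S_sub).M.logμ
        ((ofTensor X 𝔽 d T T_prime S_sub).M.hullUTheta (ofTensor X 𝔽 d T T_prime S_sub).ind3 p j e) ≤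
      (ofTensor X 𝔽 d T T_prime S_sub).M.logμ
          ((ofTensor X 𝔽 d T T_prime S_sub).M.region (ofTensor X 𝔽 d T T_prime S_sub).tΘ p j e)
        + ((X.thetaPilot ⟨j - 1, by omega⟩ (e (Fin.last j)).1 * logNorm F (e (Fin.last j)).1
              / localDegree F (e (Fin.last j)).1
            - X.thetaPilot ⟨j - 1, by omega⟩ (e i₀).1 * logNorm F (e i₀).1 / localDegree F (e i₀).1)
          + (dSum p (fun a => (𝔽 p hp.out).k (e a)) + 1) * Real.log p
          + ∑ a ∈ Istar, (3 + Real.log (absRamificationIdx p ((𝔽 p hp.out).k (e a))))) := by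
  obtain ⟨i, rfl⟩ : ∃ i : ℕ, j = i + 1 := ⟨j - 1, by omega⟩
  have hi : i < X.lstar := by omega
  exact componentBound_ofTensor X 𝔽 d T T_prime S_sub ⟨i, hi⟩ e h12 hsharp Istar htame i₀ hmin

/-- **D9′ for Dupuy–Hilado data over the real tensor-packet model, assembled: `EstimateDH` with an EXPLICIT
constant.** If [IUTchIV] Prop. 1.2 (ii) holds for every packet over the primes of `T` (a theorem of the
Prop. 1.1/1.2 companions) and the (Ind3)-datum is SHARP on every `S_{j+1}`-orbit over `T`, then
`ln ν̄_𝕃(hull(U_Θ)) ≤ ln ν̄_𝕃(O_𝕃(−P_Θ)) + Σ_{p∈T} (1/ℓ⋇)·Σ_j Σ_{v⃗} δ(p,j,v⃗)·Π_k Pr(v_k)` with the per-summand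
`δ(p,j,v⃗) = {θ(v_j) − min_a θ(v_a)} + {d_I + 1}·log(p) + Σ_{a : e_a > p−2}{3 + log(e_a)}` (`θ(v) =
P_{Θ,j}(v)·ln|κ(v)|/n_v`; `δ := 0` outside the degrees `1 ≤ j ≤ ℓ⋇`) — abc-iut-S2's `estimateDH_of_componentBounds`
fed with `componentBound_ofTensor'`. With c312-3's squeeze (`gap_le_of_cor312DH_of_estimateDH`) this turns
Dupuy–Hilado's (1.1) for the real model into `deĝ̲_lgp(P_Θ) − deĝ̲(P_q) ≤` that constant. HYPOTHESES named;
nothing asserted. [cite: Mochizuki2012, IUTchIV Thm 1.10 proof Steps (iv)–(viii) pp.26–30]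
[cite: DupuyHilado2025, §1 (1.1), Def. 3.6.3, §4.10–4.12] [claim: Mochizuki2012, status: disputed] -/
theorem estimateDH_ofTensor_of_sharp (X : PilotData F) (𝔽 : LocalFieldFamily F)
    (d : ∀ (p : ℕ) (hp : p.Prime), (@realPrimePacket F _ _ p ⟨hp⟩ (𝔽 p hp)).DHDatum X)
    (T : Finset ℕ) (T_prime : ∀ p ∈ T, p.Prime) (S_sub : ∀ v ∈ X.S, residueChar F v ∈ T)
    (h12 : ∀ (p : ℕ) [hp : Fact p.Prime] (j : ℕ) (e : Fin (j + 1) → placesOver F p),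
      p ∈ T → Prop12ii p (fun a => (𝔽 p hp.out).k (e a)))
    (hsharp : ∀ p ∈ T, ∀ (j : ℕ) (e : Fin (j + 1) → placesOver F p) (σ : Equiv.Perm (Fin (j + 1))),
      (ofTensor X 𝔽 d T T_prime S_sub).ind3.bare3 p j (e ∘ σ) ⊆
        (ofTensor X 𝔽 d T T_prime S_sub).M.region (ofTensor X 𝔽 d T T_prime S_sub).tΘ p j (e ∘ σ)) :
    (ofTensor X 𝔽 d T T_prime S_sub).EstimateDH
      (∑ p ∈ T, (1 / (X.lstar : ℝ)) * ∑ i : Fin X.lstar, ∑ e : Fin ((i : ℕ) + 1 + 1) → placesOver F p,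
        (fun (p j : ℕ) (e : Fin (j + 1) → placesOver F p) =>
          if h : p.Prime ∧ 0 < j ∧ j - 1 < X.lstar then
            haveI : Fact p.Prime := ⟨h.1⟩
            (X.thetaPilot ⟨j - 1, h.2.2⟩ (e (Fin.last j)).1 * logNorm F (e (Fin.last j)).1
                / localDegree F (e (Fin.last j)).1
              - Finset.univ.inf' ⟨0, Finset.mem_univ _⟩ (fun a =>
                  X.thetaPilot ⟨j - 1, h.2.2⟩ (e a).1 * logNorm F (e a).1 / localDegree F (e a).1))
            + (dSum p (fun a => (𝔽 p h.1).k (e a)) + 1) * Real.log p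
            + ∑ a ∈ Finset.univ.filter (fun a => p - 2 < absRamificationIdx p ((𝔽 p h.1).k (e a))),
                (3 + Real.log (absRamificationIdx p ((𝔽 p h.1).k (e a))))
          else 0) p ((i : ℕ) + 1) e * ∏ k, weight F (e k).1) := by
  refine (ofTensor X 𝔽 d T T_prime S_sub).estimateDH_of_componentBounds
    (fun (p j : ℕ) (e : Fin (j + 1) → placesOver F p) =>
      if h : p.Prime ∧ 0 < j ∧ j - 1 < X.lstar then
        haveI : Fact p.Prime := ⟨h.1⟩
        (X.thetaPilot ⟨j - 1, h.2.2⟩ (e (Fin.last j)).1 * logNorm F (e (Fin.last j)).1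
            / localDegree F (e (Fin.last j)).1
          - Finset.univ.inf' ⟨0, Finset.mem_univ _⟩ (fun a =>
              X.thetaPilot ⟨j - 1, h.2.2⟩ (e a).1 * logNorm F (e a).1 / localDegree F (e a).1))
        + (dSum p (fun a => (𝔽 p h.1).k (e a)) + 1) * Real.log p
        + ∑ a ∈ Finset.univ.filter (fun a => p - 2 < absRamificationIdx p ((𝔽 p h.1).k (e a))),
            (3 + Real.log (absRamificationIdx p ((𝔽 p h.1).k (e a))))
      else 0) ?_
  intro p hpT j hj1 hj2 e
  haveI hp : Fact p.Prime := ⟨T_prime p hpT⟩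
  have hc : p.Prime ∧ 0 < j ∧ j - 1 < X.lstar := ⟨T_prime p hpT, hj1, by
    change j ≤ X.lstar at hj2
    omega⟩
  rw [dif_pos hc]
  -- a slot of least `θ`
  obtain ⟨i₀, -, hi₀⟩ := Finset.exists_min_image Finset.univ
    (fun a : Fin (j + 1) => X.thetaPilot ⟨j - 1, hc.2.2⟩ (e a).1 * logNorm F (e a).1 / localDegree F (e a).1)
    ⟨0, Finset.mem_univ _⟩
  have hcb := componentBound_ofTensor' X 𝔽 d T T_prime S_sub hj1 hj2 e (h12 p j e hpT)
    (fun σ => hsharp p hpT j e σ)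
    (Finset.univ.filter (fun a => p - 2 < absRamificationIdx p ((𝔽 p hp.out).k (e a))))
    (fun a ha => by
      rw [Finset.mem_filter, not_and] at ha
      exact Nat.le_of_not_lt (ha (Finset.mem_univ a)))
    i₀ (fun a => hi₀ a (Finset.mem_univ a))
  have hinf : Finset.univ.inf' ⟨0, Finset.mem_univ _⟩ (fun a : Fin (j + 1) =>
      X.thetaPilot ⟨j - 1, hc.2.2⟩ (e a).1 * logNorm F (e a).1 / localDegree F (e a).1) ≤
      X.thetaPilot ⟨j - 1, hc.2.2⟩ (e i₀).1 * logNorm F (e i₀).1 / localDegree F (e i₀).1 :=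
    Finset.inf'_le _ (Finset.mem_univ i₀)
  linarith

/-- **Dupuy–Hilado's (1.1) for the real model ⟹ an explicit Diophantine inequality** (c312-3's squeeze
`gap_le_of_cor312DH_of_estimateDH` fed with `estimateDH_ofTensor_of_sharp`): under the same two named inputs,
`Cor312DH` of the real datum gives `deĝ̲_lgp(P_Θ) − deĝ̲(P_q) ≤ Σ_{p∈T} (1/ℓ⋇)·Σ_j Σ_{v⃗} δ(p,j,v⃗)·Π_k Pr(v_k)`.
`Cor312DH` is a HYPOTHESIS ([IUTchIII] Cor. 3.12 in Dupuy–Hilado's form); nothing asserted.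
[claim: Mochizuki2012, status: disputed] [cite: DupuyHilado2025, §1 (1.1)] -/
theorem gap_le_ofTensor_of_sharp (X : PilotData F) (𝔽 : LocalFieldFamily F)
    (d : ∀ (p : ℕ) (hp : p.Prime), (@realPrimePacket F _ _ p ⟨hp⟩ (𝔽 p hp)).DHDatum X)
    (T : Finset ℕ) (T_prime : ∀ p ∈ T, p.Prime) (S_sub : ∀ v ∈ X.S, residueChar F v ∈ T)
    (h12 : ∀ (p : ℕ) [hp : Fact p.Prime] (j : ℕ) (e : Fin (j + 1) → placesOver F p),
      p ∈ T → Prop12ii p (fun a => (𝔽 p hp.out).k (e a)))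
    (hsharp : ∀ p ∈ T, ∀ (j : ℕ) (e : Fin (j + 1) → placesOver F p) (σ : Equiv.Perm (Fin (j + 1))),
      (ofTensor X 𝔽 d T T_prime S_sub).ind3.bare3 p j (e ∘ σ) ⊆
        (ofTensor X 𝔽 d T T_prime S_sub).M.region (ofTensor X 𝔽 d T T_prime S_sub).tΘ p j (e ∘ σ))
    (h11 : (ofTensor X 𝔽 d T T_prime S_sub).Cor312DH) :
    LgpDivisor.ndegLgp X.thetaPilot - FinDivisor.ndeg F X.qPilot ≤
      (∑ p ∈ T, (1 / (X.lstar : ℝ)) * ∑ i : Fin X.lstar, ∑ e : Fin ((i : ℕ) + 1 + 1) → placesOver F p,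
        (fun (p j : ℕ) (e : Fin (j + 1) → placesOver F p) =>
          if h : p.Prime ∧ 0 < j ∧ j - 1 < X.lstar then
            haveI : Fact p.Prime := ⟨h.1⟩
            (X.thetaPilot ⟨j - 1, h.2.2⟩ (e (Fin.last j)).1 * logNorm F (e (Fin.last j)).1
                / localDegree F (e (Fin.last j)).1
              - Finset.univ.inf' ⟨0, Finset.mem_univ _⟩ (fun a =>
                  X.thetaPilot ⟨j - 1, h.2.2⟩ (e a).1 * logNorm F (e a).1 / localDegree F (e a).1))
            + (dSum p (fun a => (𝔽 p h.1).k (e a)) + 1) * Real.log p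
            + ∑ a ∈ Finset.univ.filter (fun a => p - 2 < absRamificationIdx p ((𝔽 p h.1).k (e a))),
                (3 + Real.log (absRamificationIdx p ((𝔽 p h.1).k (e a))))
          else 0) p ((i : ℕ) + 1) e * ∏ k, weight F (e k).1) :=
  (ofTensor X 𝔽 d T T_prime S_sub).gap_le_of_cor312DH_of_estimateDH h11
    (estimateDH_ofTensor_of_sharp X 𝔽 d T T_prime S_sub h12 hsharp)


/-- The same with [IUTchIV] Prop. 1.2 (ii) DISCHARGED (`prop12ii_holds`, the Prop. 1.1/1.2 companions of
abc-iut-S5/S6): `EstimateDH` for the real model under the SHARP (Ind3) reading alone.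
[cite: Mochizuki2012, IUTchIV Thm 1.10 proof Steps (iv)–(viii) pp.26–30] [claim: Mochizuki2012, status: disputed] -/
theorem estimateDH_ofTensor_of_sharp' (X : PilotData F) (𝔽 : LocalFieldFamily F)
    (d : ∀ (p : ℕ) (hp : p.Prime), (@realPrimePacket F _ _ p ⟨hp⟩ (𝔽 p hp)).DHDatum X)
    (T : Finset ℕ) (T_prime : ∀ p ∈ T, p.Prime) (S_sub : ∀ v ∈ X.S, residueChar F v ∈ T)
    (hsharp : ∀ p ∈ T, ∀ (j : ℕ) (e : Fin (j + 1) → placesOver F p) (σ : Equiv.Perm (Fin (j + 1))),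
      (ofTensor X 𝔽 d T T_prime S_sub).ind3.bare3 p j (e ∘ σ) ⊆
        (ofTensor X 𝔽 d T T_prime S_sub).M.region (ofTensor X 𝔽 d T T_prime S_sub).tΘ p j (e ∘ σ)) :
    (ofTensor X 𝔽 d T T_prime S_sub).EstimateDH
      (∑ p ∈ T, (1 / (X.lstar : ℝ)) * ∑ i : Fin X.lstar, ∑ e : Fin ((i : ℕ) + 1 + 1) → placesOver F p,
        (fun (p j : ℕ) (e : Fin (j + 1) → placesOver F p) =>
          if h : p.Prime ∧ 0 < j ∧ j - 1 < X.lstar then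
            haveI : Fact p.Prime := ⟨h.1⟩
            (X.thetaPilot ⟨j - 1, h.2.2⟩ (e (Fin.last j)).1 * logNorm F (e (Fin.last j)).1
                / localDegree F (e (Fin.last j)).1
              - Finset.univ.inf' ⟨0, Finset.mem_univ _⟩ (fun a =>
                  X.thetaPilot ⟨j - 1, h.2.2⟩ (e a).1 * logNorm F (e a).1 / localDegree F (e a).1))
            + (dSum p (fun a => (𝔽 p h.1).k (e a)) + 1) * Real.log p
            + ∑ a ∈ Finset.univ.filter (fun a => p - 2 < absRamificationIdx p ((𝔽 p h.1).k (e a))),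
                (3 + Real.log (absRamificationIdx p ((𝔽 p h.1).k (e a))))
          else 0) p ((i : ℕ) + 1) e * ∏ k, weight F (e k).1) :=
  estimateDH_ofTensor_of_sharp X 𝔽 d T T_prime S_sub (fun p _ _ _ _ => prop12ii_holds p _) hsharp

/-- … and the squeeze with Prop. 1.2 (ii) discharged: `Cor312DH` (HYPOTHESIS) and the sharp (Ind3) reading give
`deĝ̲_lgp(P_Θ) − deĝ̲(P_q) ≤` the explicit constant. [claim: Mochizuki2012, status: disputed] -/
theorem gap_le_ofTensor_of_sharp' (X : PilotData F) (𝔽 : LocalFieldFamily F)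
    (d : ∀ (p : ℕ) (hp : p.Prime), (@realPrimePacket F _ _ p ⟨hp⟩ (𝔽 p hp)).DHDatum X)
    (T : Finset ℕ) (T_prime : ∀ p ∈ T, p.Prime) (S_sub : ∀ v ∈ X.S, residueChar F v ∈ T)
    (hsharp : ∀ p ∈ T, ∀ (j : ℕ) (e : Fin (j + 1) → placesOver F p) (σ : Equiv.Perm (Fin (j + 1))),
      (ofTensor X 𝔽 d T T_prime S_sub).ind3.bare3 p j (e ∘ σ) ⊆
        (ofTensor X 𝔽 d T T_prime S_sub).M.region (ofTensor X 𝔽 d T T_prime S_sub).tΘ p j (e ∘ σ))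
    (h11 : (ofTensor X 𝔽 d T T_prime S_sub).Cor312DH) :
    LgpDivisor.ndegLgp X.thetaPilot - FinDivisor.ndeg F X.qPilot ≤
      (∑ p ∈ T, (1 / (X.lstar : ℝ)) * ∑ i : Fin X.lstar, ∑ e : Fin ((i : ℕ) + 1 + 1) → placesOver F p,
        (fun (p j : ℕ) (e : Fin (j + 1) → placesOver F p) =>
          if h : p.Prime ∧ 0 < j ∧ j - 1 < X.lstar then
            haveI : Fact p.Prime := ⟨h.1⟩
            (X.thetaPilot ⟨j - 1, h.2.2⟩ (e (Fin.last j)).1 * logNorm F (e (Fin.last j)).1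
                / localDegree F (e (Fin.last j)).1
              - Finset.univ.inf' ⟨0, Finset.mem_univ _⟩ (fun a =>
                  X.thetaPilot ⟨j - 1, h.2.2⟩ (e a).1 * logNorm F (e a).1 / localDegree F (e a).1))
            + (dSum p (fun a => (𝔽 p h.1).k (e a)) + 1) * Real.log p
            + ∑ a ∈ Finset.univ.filter (fun a => p - 2 < absRamificationIdx p ((𝔽 p h.1).k (e a))),
                (3 + Real.log (absRamificationIdx p ((𝔽 p h.1).k (e a))))
          else 0) p ((i : ℕ) + 1) e * ∏ k, weight F (e k).1) :=
  gap_le_ofTensor_of_sharp X 𝔽 d T T_prime S_sub (fun p _ _ _ _ => prop12ii_holds p _) hsharp h11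

end DHData

end Summit.ABC.IUTFork

end
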